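import Mathlib.MeasureTheory.Measure.Haar.Quotient
import Mathlib.Topology.Compactness.Lindelof

/-!
# T5CocompactCovolume — a discrete cocompact subgroup has countable order type and finite covolume

Cell pub-hodge-repro2, seat p5, Tier 5 (route/T5-N4-p5.md, N4.3 v13 (B2): «Γ_i is DISCRETE in
G_∞ … and COCOMPACT», «the right coset space and its invariant Radon measure»).  Rows 59 / 61
(`T5KernelIdentity`, `T5RightCosetDecomposition`) prove [DE] Theorem 9.2.2 for `L²(G ⧸ Γ, μ_𝓕)`
and `L²(Γ\G)` with `μ_𝓕 = map mk (μ.restrict 𝓕)` the quotient measure of a fundamental domain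
`𝓕`, under the instance hypotheses `[Countable Γ]` and `[IsFiniteMeasure μ_𝓕]` left to the reader.
This file discharges both from the datum:

* `instIsCancelSMulOp`: the right action of `Γ.op` on `G` is cancellative (for the existence of
  a fundamental domain, `FundamentalDomainExists.exists_isFundamentalDomain_of_properlyDiscontinuousSMul`);
* `countable_of_discreteTopology`: a discrete subgroup of a second countable topological group is
  COUNTABLE (a second countable space is Lindelöf, and a Lindelöf discrete space is countable);
* `exists_isCompact_image_mk_eq_univ`: if `G` is locally compact and `G ⧸ Γ` is compact, some
  COMPACT `K ⊆ G` maps onto `G ⧸ Γ` (finite subcover of the open quotient map);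
* `iUnion_smul_eq_univ_of_image_mk_eq_univ`: then `G = ⋃ γ ∈ Γ, K γ`;
* `measure_le_of_image_mk_eq_univ`, `measure_lt_top_of_compactSpace`: for a right-invariant `μ`
  finite on compacts, EVERY fundamental domain `𝓕` of `Γ.op` has `μ 𝓕 ≤ μ K < ∞`
  (`𝓕 ⊆ ⋃ γ, γ • K`, countable subadditivity and `IsFundamentalDomain.measure_eq_tsum`);
* `isFiniteMeasure_quotientMeasure`: hence `μ_𝓕` is a FINITE measure — the instance hypothesis
  `[IsFiniteMeasure μ_𝓕]` of rows 59 / 61.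

Mathlib only.  Axioms: propext, Classical.choice, Quot.sound.
README §8(d): uses an L-value-free non-vanishing device: NO.
-/

namespace Summit.Ventures.HodgeRepro2.T5CocompactCovolume

open MeasureTheory Set Filter Topology
open scoped ENNReal Pointwise

variable {G : Type*} [Group G]

/-- The right action `γ • x = x * γ` of `Γ.op` on `G` is cancellative on both sides. -/
instance instIsCancelSMulOp (Γ : Subgroup G) : IsCancelSMul Γ.op G where
  left_cancel' a b c h := by
    have h' : b * (a : Gᵐᵒᵖ).unop = c * (a : Gᵐᵒᵖ).unop := h
    exact mul_right_cancel h'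
  right_cancel' a b c h := by
    have h' : c * (a : Gᵐᵒᵖ).unop = c * (b : Gᵐᵒᵖ).unop := h
    exact Subtype.ext (MulOpposite.unop_injective (mul_left_cancel h'))

/-- A discrete subgroup of a second countable topological group is countable. -/
theorem countable_of_discreteTopology [TopologicalSpace G] [SecondCountableTopology G]
    (Γ : Subgroup G) [DiscreteTopology Γ] : Countable Γ :=
  countable_of_Lindelof_of_discrete

variable [TopologicalSpace G] [IsTopologicalGroup G]

/-- **Cocompact ⇒ a compact set maps onto the quotient**: if `G` is locally compact and `G ⧸ Γ`
is compact, some compact `K ⊆ G` satisfies `mk '' K = univ` (cover `G ⧸ Γ` by the images of the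
interiors of compact neighbourhoods, which are open since `mk` is an open map, and take a finite
subcover). -/
theorem exists_isCompact_image_mk_eq_univ [LocallyCompactSpace G] (Γ : Subgroup G)
    [CompactSpace (G ⧸ Γ)] :
    ∃ K : Set G, IsCompact K ∧ (QuotientGroup.mk : G → G ⧸ Γ) '' K = univ := by
  choose C hC _ hCc using fun x : G => LocallyCompactSpace.local_compact_nhds x univ univ_mem
  have hCo : ∀ x, IsOpen ((QuotientGroup.mk : G → G ⧸ Γ) '' interior (C x)) := fun x =>
    QuotientGroup.isOpenMap_coe _ isOpen_interior
  have hcov : (univ : Set (G ⧸ Γ)) ⊆ ⋃ x, (QuotientGroup.mk : G → G ⧸ Γ) '' interior (C x) := by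
    rintro q -
    obtain ⟨x, rfl⟩ := QuotientGroup.mk_surjective q
    exact mem_iUnion.2 ⟨x, mem_image_of_mem _ (mem_interior_iff_mem_nhds.2 (hC x))⟩
  obtain ⟨t, ht⟩ := isCompact_univ.elim_finite_subcover _ hCo hcov
  refine ⟨⋃ x ∈ t, C x, t.isCompact_biUnion fun x _ => hCc x, ?_⟩
  refine eq_univ_of_forall fun q => ?_
  obtain ⟨i, hi, y, hy, rfl⟩ := mem_iUnion₂.1 (ht (mem_univ q))
  exact ⟨y, mem_iUnion₂.2 ⟨i, hi, interior_subset hy⟩, rfl⟩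

omit [TopologicalSpace G] [IsTopologicalGroup G] in
/-- If `mk '' K = univ` then every point of `G` is a right `Γ`-translate of a point of `K`:
`⋃ γ : Γ.op, γ • K = univ`. -/
theorem iUnion_smul_eq_univ_of_image_mk_eq_univ {Γ : Subgroup G} {K : Set G}
    (hK : (QuotientGroup.mk : G → G ⧸ Γ) '' K = univ) : ⋃ γ : Γ.op, γ • K = univ := by
  refine eq_univ_of_forall fun x => ?_
  have hx : ((x : G) : G ⧸ Γ) ∈ (QuotientGroup.mk : G → G ⧸ Γ) '' K := hK ▸ mem_univ _
  obtain ⟨k, hk, hkx⟩ := hx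
  have hγ : k⁻¹ * x ∈ Γ := QuotientGroup.eq.1 hkx
  refine mem_iUnion.2 ⟨⟨MulOpposite.op (k⁻¹ * x), Subgroup.mem_op.2 (by simpa using hγ)⟩, k, hk, ?_⟩
  show k * (k⁻¹ * x) = x
  exact mul_inv_cancel_left k x

variable [MeasurableSpace G] [BorelSpace G]

/-- **Finite covolume from cocompactness**: for a right-invariant `μ`, a countable `Γ`, a
fundamental domain `𝓕` of `Γ.op` and a set `K` with `mk '' K = univ`, `μ 𝓕 ≤ μ K`
(`𝓕 ⊆ ⋃ γ, γ • K`, countable subadditivity, and `μ K = ∑' γ, μ (γ • K ∩ 𝓕)` for the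
fundamental domain `𝓕`). -/
theorem measure_le_of_image_mk_eq_univ (μ : Measure G) [μ.IsMulRightInvariant] {Γ : Subgroup G}
    [Countable Γ] {𝓕 : Set G} (h𝓕 : IsFundamentalDomain Γ.op 𝓕 μ) {K : Set G}
    (hK : (QuotientGroup.mk : G → G ⧸ Γ) '' K = univ) : μ 𝓕 ≤ μ K :=
  calc μ 𝓕 = μ (𝓕 ∩ ⋃ γ : Γ.op, γ • K) := by
        rw [iUnion_smul_eq_univ_of_image_mk_eq_univ hK, inter_univ]
    _ = μ (⋃ γ : Γ.op, 𝓕 ∩ γ • K) := by rw [inter_iUnion]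
    _ ≤ ∑' γ : Γ.op, μ (𝓕 ∩ γ • K) := measure_iUnion_le _
    _ = ∑' γ : Γ.op, μ (γ • K ∩ 𝓕) := by simp_rw [inter_comm]
    _ = μ K := (h𝓕.measure_eq_tsum K).symm

/-- **A fundamental domain of a cocompact subgroup has finite measure**: `G` locally compact,
`G ⧸ Γ` compact, `μ` right-invariant and finite on compacts, `Γ` countable. -/
theorem measure_lt_top_of_compactSpace [LocallyCompactSpace G] (μ : Measure G)
    [μ.IsMulRightInvariant] [IsFiniteMeasureOnCompacts μ] {Γ : Subgroup G} [Countable Γ]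
    [CompactSpace (G ⧸ Γ)] {𝓕 : Set G} (h𝓕 : IsFundamentalDomain Γ.op 𝓕 μ) : μ 𝓕 < ∞ := by
  obtain ⟨K, hKc, hK⟩ := exists_isCompact_image_mk_eq_univ Γ
  exact (measure_le_of_image_mk_eq_univ μ h𝓕 hK).trans_lt hKc.measure_lt_top

/-- The restriction of `μ` to a fundamental domain of a cocompact subgroup is a finite measure. -/
theorem isFiniteMeasure_restrict_of_compactSpace [LocallyCompactSpace G] (μ : Measure G)
    [μ.IsMulRightInvariant] [IsFiniteMeasureOnCompacts μ] {Γ : Subgroup G} [Countable Γ]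
    [CompactSpace (G ⧸ Γ)] {𝓕 : Set G} (h𝓕 : IsFundamentalDomain Γ.op 𝓕 μ) :
    IsFiniteMeasure (μ.restrict 𝓕) :=
  isFiniteMeasure_restrict.2 (measure_lt_top_of_compactSpace μ h𝓕).ne

/-- **The quotient measure `μ_𝓕 = map mk (μ.restrict 𝓕)` is FINITE** for a cocompact `Γ` — the
instance hypothesis `[IsFiniteMeasure μ_𝓕]` of rows 59 / 61, discharged from the datum
(`G` locally compact, `G ⧸ Γ` compact, `μ` right-invariant and finite on compacts, `Γ`
countable); stated for ANY measurable structure on `G ⧸ Γ`. -/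
theorem isFiniteMeasure_quotientMeasure [LocallyCompactSpace G] (μ : Measure G)
    [μ.IsMulRightInvariant] [IsFiniteMeasureOnCompacts μ] {Γ : Subgroup G} [Countable Γ]
    [CompactSpace (G ⧸ Γ)] [MeasurableSpace (G ⧸ Γ)] {𝓕 : Set G}
    (h𝓕 : IsFundamentalDomain Γ.op 𝓕 μ) :
    IsFiniteMeasure (Measure.map (QuotientGroup.mk : G → G ⧸ Γ) (μ.restrict 𝓕)) :=
  haveI := isFiniteMeasure_restrict_of_compactSpace μ h𝓕
  Measure.isFiniteMeasure_map _ _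

end Summit.Ventures.HodgeRepro2.T5CocompactCovolume
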